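import Summits.ValiantsHypothesis.ValiantsHypothesis.Theorems.LacunarySymmetroidMatrixDescartesGraftToolkit

/-!
# `MatrixDescartes` census — THE FLAG CERTIFICATE: a grafted row from sign data of the SOURCE pencil's trailing minors

HONEST FRAMING.  Object-search cell `pub-symmetroid`, crux `Theses.LacunarySymmetroid.MatrixDescartes`
(stmt-ValiantsHypothesis-18050); seat val-sym-mdr-p1 (g3).  LOWER-bound / certificate mathematics in census (CONJECTURE-A) currency:
the kernel form of the cell's whole FLAG-LADDER STEP (`HOME/CONJECTURE.md` §2.1c REGIME / FLAG LEMMA, §3 A-flag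
`ζ(m,K+1) ≥ ζ(m,K) + m + Γ_m(K)`), as a CERTIFICATE THEOREM.  Nothing here bears on the crux `MatrixDescartes` (an upper bound at fat
formats), on `DoorA26` / `DoorA34`, or on `VP ≠ VNP`.  No definitions.

THE THEOREM (`exists_flag_certificate`, row form `not_posRootLawAt_of_flag_certificate`).  Data: real symmetric letters `T l` (`l < K`,
size `m`; in practice an engine's extremal pencil ALREADY CONGRUENCED into the frame of the intended flag, `T l = Pᵀ S l P`), exponents `d`,
positive thresholds `θ_b` (`b < m`), strictly increasing positive test points `τ_0 < ⋯ < τ_L`, and for each test point its WINDOW INDEX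
`a_j ≤ m` with `θ_b < τ_j` for `b < a_j` and `τ_j < θ_b` for `b ≥ a_j`, consecutive windows equal or adjacent.  Hypotheses to CHECK
(rational arithmetic on the SOURCE pencil only — small degrees, small numbers): the trailing principal minor of `∑ l, τ_j^(d l) • T l` on the
coordinates `b ≥ a_j` is nonzero at every `τ_j`, and two consecutive test points in the SAME window give that minor opposite signs.
Conclusion: for some `D` (larger than every `d l`) and nonzero signs `σ_b`, the `(K+1)`-letter real symmetric pencil
`T + X^D • diagonal (σ_b θ_b^{−D})` has nonzero determinant of alternating sign along ALL of `τ_0 < ⋯ < τ_L` — `L` alternations, hence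
`¬ PosRootLawAt m (K+1) (L − 1)`.  Mechanism: at `τ_j` the coordinates `b < a_j` are ON and the tree's FLAG LEMMA
(`Census.Flag.eventually_det_mul_pos`, seat g2; named-ON form `Graft.eventually_det_mul_pos_on`) gives the eventual sign
`(∏_{b < a_j} σ_b) · (minor on b ≥ a_j)`; inside a window this alternates by hypothesis, across a junction `a → a+1` the fresh sign `σ_a`
(chosen here as minus the product of the two adjacent minors) makes it alternate; finitely many eventual statements ⇒ one `D`.
USE.  An engine-found flag graft (the cell's CAP / graft rows, realised numerically at `D = 623` with 500-digit integer entries) becomes a kernel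
row for EVERY large `D` from the SMALL source pencil: certify the minors' signs at rational points and apply `not_posRootLawAt_of_flag_certificate`.
The seat's GRAFT LAW (`…GraftLaw.lean`) is the special case «all thresholds just beyond the last source test point, eigenframe».  [folklore]
-/

-- `Summit.ValiantsHypothesis.ValiantsHypothesis.…` repeats a component by the D-0017 layout
-- (single-conjunct summit), which the `dupNamespace` linter flags; the name is mandated.
set_option linter.dupNamespace false

namespace Summit.ValiantsHypothesis.ValiantsHypothesis.Theorems.LacunarySymmetroidMatrixDescartes.Census.Graft

open Matrix Finset Filter Topology
open scoped BigOperators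

/-- Splitting off the coordinate `a` from the ON-product `∏_{b < a+1}`. [folklore] -/
theorem prod_filter_lt_succ {m : ℕ} (σ : Fin m → ℝ) (a : ℕ) (ha : a < m) :
    ∏ b ∈ univ.filter (fun b : Fin m => (b : ℕ) < a + 1), σ b
      = σ ⟨a, ha⟩ * ∏ b ∈ univ.filter (fun b : Fin m => (b : ℕ) < a), σ b := by
  rw [Finset.prod_filter, Finset.prod_filter, ← Finset.mul_prod_erase univ _ (Finset.mem_univ (⟨a, ha⟩ : Fin m)),
    ← Finset.mul_prod_erase univ (fun b : Fin m => if (b : ℕ) < a then σ b else 1) (Finset.mem_univ (⟨a, ha⟩ : Fin m))]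
  simp only [lt_add_iff_pos_right, zero_lt_one, if_true, lt_irrefl, if_false, one_mul]
  congr 1
  refine Finset.prod_congr rfl fun b hb => ?_
  have hne : (b : ℕ) ≠ a := fun h => (Finset.ne_of_mem_erase hb) (Fin.ext h)
  by_cases h1 : (b : ℕ) < a
  · simp [h1, Nat.lt_succ_of_lt h1]
  · have h2 : ¬ (b : ℕ) < a + 1 := by omega
    simp [h1, h2]

/-- **THE FLAG CERTIFICATE THEOREM** (see the module docstring): sign data of the trailing principal minors of the SOURCE pencil along
windowed test points ⇒ for some lacunarity `D` and signs `σ`, the grafted `(K+1)`-letter pencil `T + X^D • diagonal (σ_b θ_b^{−D})`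
alternates along all the test points. [folklore] -/
theorem exists_flag_certificate {m K L : ℕ} (d : Fin K → ℕ) (T : Fin K → Matrix (Fin m) (Fin m) ℝ)
    (θ : Fin m → ℝ) (hθ : ∀ b, 0 < θ b)
    (τ : Fin (L + 1) → ℝ) (hτ : StrictMono τ) (hpos : ∀ j, 0 < τ j)
    (a : Fin (L + 1) → ℕ) (ha : ∀ j, a j ≤ m)
    (hON : ∀ j (b : Fin m), (b : ℕ) < a j → θ b < τ j) (hOFF : ∀ j (b : Fin m), a j ≤ (b : ℕ) → τ j < θ b)
    (hjump : ∀ j : Fin L, a j.succ = a j.castSucc ∨ a j.succ = a j.castSucc + 1)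
    (hM : ∀ j, ((∑ l, τ j ^ d l • T l).submatrix
        ((↑) : ↥((univ.filter (fun b : Fin m => (b : ℕ) < a j))ᶜ) → Fin m)
        ((↑) : ↥((univ.filter (fun b : Fin m => (b : ℕ) < a j))ᶜ) → Fin m)).det ≠ 0)
    (hsame : ∀ j : Fin L, a j.succ = a j.castSucc →
      ((∑ l, τ j.castSucc ^ d l • T l).submatrix
          ((↑) : ↥((univ.filter (fun b : Fin m => (b : ℕ) < a j.castSucc))ᶜ) → Fin m)
          ((↑) : ↥((univ.filter (fun b : Fin m => (b : ℕ) < a j.castSucc))ᶜ) → Fin m)).det *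
        ((∑ l, τ j.succ ^ d l • T l).submatrix
          ((↑) : ↥((univ.filter (fun b : Fin m => (b : ℕ) < a j.castSucc))ᶜ) → Fin m)
          ((↑) : ↥((univ.filter (fun b : Fin m => (b : ℕ) < a j.castSucc))ᶜ) → Fin m)).det < 0) :
    ∃ (D : ℕ) (σ : Fin m → ℝ), (∀ l, d l < D) ∧ (∀ b, σ b ≠ 0) ∧
      (∀ j, (∑ l, τ j ^ (Fin.snoc d D : Fin (K + 1) → ℕ) l •
        (Fin.snoc T (diagonal fun b => σ b * (θ b)⁻¹ ^ D) : Fin (K + 1) → Matrix (Fin m) (Fin m) ℝ) l).det ≠ 0) ∧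
      ∀ j : Fin L,
        (∑ l, τ j.castSucc ^ (Fin.snoc d D : Fin (K + 1) → ℕ) l •
          (Fin.snoc T (diagonal fun b => σ b * (θ b)⁻¹ ^ D) : Fin (K + 1) → Matrix (Fin m) (Fin m) ℝ) l).det *
        (∑ l, τ j.succ ^ (Fin.snoc d D : Fin (K + 1) → ℕ) l •
          (Fin.snoc T (diagonal fun b => σ b * (θ b)⁻¹ ^ D) : Fin (K + 1) → Matrix (Fin m) (Fin m) ℝ) l).det < 0 := by
  classical
  -- notation-free abbreviations
  set ON : ℕ → Finset (Fin m) := fun c => univ.filter (fun b : Fin m => (b : ℕ) < c) with hONdef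
  set μ : ℕ → ℝ → ℝ := fun c y =>
    ((∑ l, y ^ d l • T l).submatrix ((↑) : ↥((ON c)ᶜ) → Fin m) ((↑) : ↥((ON c)ᶜ) → Fin m)).det with hμ
  have hM' : ∀ j, μ (a j) (τ j) ≠ 0 := hM
  have hsame' : ∀ j : Fin L, a j.succ = a j.castSucc →
      μ (a j.castSucc) (τ j.castSucc) * μ (a j.castSucc) (τ j.succ) < 0 := hsame
  -- `a` is monotone along the test points
  have hmono : ∀ j₁ j₂ : Fin (L + 1), j₁ ≤ j₂ → a j₁ ≤ a j₂ := by
    intro j₁ j₂ hle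
    by_contra hlt
    have hlt' : a j₂ < a j₁ := not_le.mp hlt
    have hbm : a j₂ < m := lt_of_lt_of_le hlt' (ha j₁)
    have h1 := hON j₁ ⟨a j₂, hbm⟩ hlt'
    have h2 := hOFF j₂ ⟨a j₂, hbm⟩ le_rfl
    have h3 : τ j₁ ≤ τ j₂ := hτ.monotone hle
    linarith
  -- the junction signs: `σ_c` = minus the product of the two minors adjacent to the junction `c → c+1` (if any), else `1`
  set cj : Fin L → ℝ := fun j => -(μ (a j.castSucc) (τ j.castSucc) * μ (a j.succ) (τ j.succ)) with hcj
  have hcjne : ∀ j, cj j ≠ 0 := fun j =>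
    neg_ne_zero.mpr (mul_ne_zero (hM' j.castSucc) (hM' j.succ))
  set σ : Fin m → ℝ := fun b =>
    ∏ j ∈ univ.filter (fun j : Fin L => a j.castSucc = (b : ℕ) ∧ a j.succ = (b : ℕ) + 1), cj j with hσ
  have hσne : ∀ b, σ b ≠ 0 := fun b => Finset.prod_ne_zero_iff.mpr fun j _ => hcjne j
  -- at a junction `a → a+1` crossed between `j` and `j+1`, `σ_a = cj j`
  have hσjump : ∀ j : Fin L, ∀ h1 : a j.succ = a j.castSucc + 1,
      σ ⟨a j.castSucc, by have := ha j.succ; omega⟩ = cj j := by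
    intro j h1
    show ∏ j' ∈ univ.filter (fun j' : Fin L => a j'.castSucc = a j.castSucc ∧ a j'.succ = a j.castSucc + 1), cj j' = cj j
    have hfilt : univ.filter (fun j' : Fin L => a j'.castSucc = a j.castSucc ∧ a j'.succ = a j.castSucc + 1) = {j} := by
      ext j'
      simp only [Finset.mem_filter, Finset.mem_univ, true_and, Finset.mem_singleton]
      constructor
      · rintro ⟨h2, h3⟩
        by_contra hne
        rcases lt_or_gt_of_ne hne with hlt | hgt
        · -- j' < j: then j'.succ ≤ j.castSucc
          have hle : (j'.succ : Fin (L + 1)) ≤ j.castSucc :=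
            Fin.le_iff_val_le_val.mpr (by simp only [Fin.val_succ, Fin.val_castSucc]; omega)
          have := hmono _ _ hle
          omega
        · have hle : (j.succ : Fin (L + 1)) ≤ j'.castSucc :=
            Fin.le_iff_val_le_val.mpr (by simp only [Fin.val_succ, Fin.val_castSucc]; omega)
          have := hmono _ _ hle
          omega
      · rintro rfl
        exact ⟨rfl, h1⟩
    rw [hfilt, Finset.prod_singleton]
  -- carriers
  set s : Fin (L + 1) → ℝ := fun j => (∏ b ∈ ON (a j), σ b) * μ (a j) (τ j) with hs
  have hPne : ∀ c, ∏ b ∈ ON c, σ b ≠ 0 := fun c => Finset.prod_ne_zero_iff.mpr fun b _ => hσne b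
  -- eventual sign at every test point = carrier (the flag lemma)
  have hev : ∀ j, ∀ᶠ D : ℕ in atTop,
      0 < ((∑ l, τ j ^ d l • T l) + diagonal (fun b => σ b * (τ j / θ b) ^ D)).det * s j := by
    intro j
    have hr : ∀ b : Fin m, 0 < τ j / θ b := fun b => div_pos (hpos j) (hθ b)
    have hrON : ∀ b, b ∈ ON (a j) ↔ 1 < τ j / θ b := by
      intro b
      show b ∈ univ.filter (fun b : Fin m => (b : ℕ) < a j) ↔ 1 < τ j / θ b
      simp only [Finset.mem_filter, Finset.mem_univ, true_and, one_lt_div (hθ b)]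
      constructor
      · exact hON j b
      · intro h
        by_contra hb
        have := hOFF j b (not_lt.mp hb)
        linarith
    have hr1 : ∀ b, τ j / θ b ≠ 1 := by
      intro b h1
      by_cases hb : (b : ℕ) < a j
      · have h2 := hON j b hb
        have : 1 < τ j / θ b := (one_lt_div (hθ b)).mpr h2
        rw [h1] at this; exact lt_irrefl 1 this
      · have h2 := hOFF j b (not_lt.mp hb)
        have : τ j / θ b < 1 := (div_lt_one (hθ b)).mpr h2
        rw [h1] at this; exact lt_irrefl 1 this
    exact eventually_det_mul_pos_on (∑ l, τ j ^ d l • T l) σ (fun b => τ j / θ b) (ON (a j)) hrON hσne hr hr1 (hM' j)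
  -- consecutive carriers have opposite signs
  have hF2 : ∀ j : Fin L, s j.castSucc * s j.succ < 0 := by
    intro j
    rcases hjump j with h0 | h1
    · -- same window
      show ((∏ b ∈ ON (a j.castSucc), σ b) * μ (a j.castSucc) (τ j.castSucc)) *
          ((∏ b ∈ ON (a j.succ), σ b) * μ (a j.succ) (τ j.succ)) < 0
      rw [h0]
      have hP : 0 < (∏ b ∈ ON (a j.castSucc), σ b) * ∏ b ∈ ON (a j.castSucc), σ b := mul_self_pos.mpr (hPne _)
      have hneg := hsame' j h0
      have : ((∏ b ∈ ON (a j.castSucc), σ b) * μ (a j.castSucc) (τ j.castSucc)) *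
          ((∏ b ∈ ON (a j.castSucc), σ b) * μ (a j.castSucc) (τ j.succ))
          = ((∏ b ∈ ON (a j.castSucc), σ b) * ∏ b ∈ ON (a j.castSucc), σ b) *
            (μ (a j.castSucc) (τ j.castSucc) * μ (a j.castSucc) (τ j.succ)) := by ring
      rw [this]
      exact mul_neg_of_pos_of_neg hP hneg
    · -- junction `a → a+1`
      have ham : a j.castSucc < m := by have := ha j.succ; omega
      show ((∏ b ∈ ON (a j.castSucc), σ b) * μ (a j.castSucc) (τ j.castSucc)) *
          ((∏ b ∈ ON (a j.succ), σ b) * μ (a j.succ) (τ j.succ)) < 0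
      have hsplit : ∏ b ∈ ON (a j.succ), σ b = σ ⟨a j.castSucc, ham⟩ * ∏ b ∈ ON (a j.castSucc), σ b := by
        rw [h1]; exact prod_filter_lt_succ σ (a j.castSucc) ham
      rw [hsplit, hσjump j h1]
      have hP : 0 < (∏ b ∈ ON (a j.castSucc), σ b) * ∏ b ∈ ON (a j.castSucc), σ b := mul_self_pos.mpr (hPne _)
      have hQ : 0 < (μ (a j.castSucc) (τ j.castSucc) * μ (a j.succ) (τ j.succ)) *
          (μ (a j.castSucc) (τ j.castSucc) * μ (a j.succ) (τ j.succ)) :=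
        mul_self_pos.mpr (mul_ne_zero (hM' _) (hM' _))
      have : ((∏ b ∈ ON (a j.castSucc), σ b) * μ (a j.castSucc) (τ j.castSucc)) *
          ((cj j * ∏ b ∈ ON (a j.castSucc), σ b) * μ (a j.succ) (τ j.succ))
          = -(((∏ b ∈ ON (a j.castSucc), σ b) * ∏ b ∈ ON (a j.castSucc), σ b) *
            ((μ (a j.castSucc) (τ j.castSucc) * μ (a j.succ) (τ j.succ)) *
              (μ (a j.castSucc) (τ j.castSucc) * μ (a j.succ) (τ j.succ)))) := by
        simp only [hcj]; ring
      rw [this]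
      exact neg_neg_of_pos (mul_pos hP hQ)
  -- one `D`
  have hev' : ∀ᶠ D : ℕ in atTop, ∀ j,
      0 < ((∑ l, τ j ^ d l • T l) + diagonal (fun b => σ b * (τ j / θ b) ^ D)).det * s j :=
    eventually_all.mpr hev
  have hDgt : ∀ᶠ D : ℕ in atTop, ∀ l : Fin K, d l < D := eventually_all.mpr fun l => eventually_gt_atTop (d l)
  obtain ⟨D, hD, hDd⟩ := (hev'.and hDgt).exists
  refine ⟨D, σ, hDd, hσne, fun j h0 => ?_, fun j => ?_⟩
  · have h := hD j
    rw [graft_eval] at h0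
    rw [h0, zero_mul] at h
    exact lt_irrefl 0 h
  · have h1 := hD j.castSucc
    have h2 := hD j.succ
    rw [graft_eval, graft_eval]
    exact mul_neg_of_carriers h1 h2 (hF2 j)

open Summit.ValiantsHypothesis.ValiantsHypothesis.Theorems.MatrixDescartes.Negative (PosRootLawAt)

/-- **FLAG CERTIFICATE ⇒ ROW.**  Under the hypotheses of `exists_flag_certificate` with `L ≥ 1` alternations and SYMMETRIC source letters,
`¬ PosRootLawAt m (K+1) (L − 1)`: some real symmetric `(K+1)`-term `m × m` lacunary pencil has at least `L` distinct positive determinant roots.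
[folklore] -/
theorem not_posRootLawAt_of_flag_certificate {m K L : ℕ} (hL : 1 ≤ L) (d : Fin K → ℕ)
    (T : Fin K → Matrix (Fin m) (Fin m) ℝ) (hT : ∀ l, (T l).IsSymm)
    (θ : Fin m → ℝ) (hθ : ∀ b, 0 < θ b)
    (τ : Fin (L + 1) → ℝ) (hτ : StrictMono τ) (hpos : ∀ j, 0 < τ j)
    (a : Fin (L + 1) → ℕ) (ha : ∀ j, a j ≤ m)
    (hON : ∀ j (b : Fin m), (b : ℕ) < a j → θ b < τ j) (hOFF : ∀ j (b : Fin m), a j ≤ (b : ℕ) → τ j < θ b)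
    (hjump : ∀ j : Fin L, a j.succ = a j.castSucc ∨ a j.succ = a j.castSucc + 1)
    (hM : ∀ j, ((∑ l, τ j ^ d l • T l).submatrix
        ((↑) : ↥((univ.filter (fun b : Fin m => (b : ℕ) < a j))ᶜ) → Fin m)
        ((↑) : ↥((univ.filter (fun b : Fin m => (b : ℕ) < a j))ᶜ) → Fin m)).det ≠ 0)
    (hsame : ∀ j : Fin L, a j.succ = a j.castSucc →
      ((∑ l, τ j.castSucc ^ d l • T l).submatrix
          ((↑) : ↥((univ.filter (fun b : Fin m => (b : ℕ) < a j.castSucc))ᶜ) → Fin m)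
          ((↑) : ↥((univ.filter (fun b : Fin m => (b : ℕ) < a j.castSucc))ᶜ) → Fin m)).det *
        ((∑ l, τ j.succ ^ d l • T l).submatrix
          ((↑) : ↥((univ.filter (fun b : Fin m => (b : ℕ) < a j.castSucc))ᶜ) → Fin m)
          ((↑) : ↥((univ.filter (fun b : Fin m => (b : ℕ) < a j.castSucc))ᶜ) → Fin m)).det < 0) :
    ¬ PosRootLawAt m (K + 1) (L - 1) := by
  obtain ⟨D, σ, -, -, -, halt⟩ := exists_flag_certificate d T θ hθ τ hτ hpos a ha hON hOFF hjump hM hsame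
  refine not_posRootLawAt_of_alternating hL (Fin.snoc d D) (Fin.snoc T (diagonal fun b => σ b * (θ b)⁻¹ ^ D)) ?_
    τ hτ hpos halt
  intro l
  refine Fin.lastCases ?_ (fun i => ?_) l
  · simp only [Fin.snoc_last]
    exact Matrix.diagonal_transpose _
  · simp only [Fin.snoc_castSucc]
    exact hT i

end Summit.ValiantsHypothesis.ValiantsHypothesis.Theorems.LacunarySymmetroidMatrixDescartes.Census.Graft
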